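import Summits.ResolutionOfSingularities.ResolutionOfSingularities.Theorems.WildConesCampaignW46HypersurfacesCharTwoNearCount

/-!
# [OURS · L1 W4.6, rung (ii) at p = 2, EVERY dimension n] CALCULUS OF DEGREE FORMS: lowest forms of
# products, degree forms vanish on high powers of the maximal ideal and on `𝔪·(∂a)` along the kernel of
# the polar form, the linear form of `∂ₛa` is the polar matrix, and EULER'S IDENTITY
# `Σₛ wₛ · (∂ₛa)_d(w) = (d+1) · a_{d+1}(w)` — the tools that turn ideal membership into vanishing of the
# tangent cubic on the kernel

HONEST FRAMING. Everything here is OURS: elementary identities for the seat's gen-5 definition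
`CampaignW46.degForm` (p522667: `degForm d f w = Σ_{|A|=d} [X^A]f · w^A`) over `κ⟦X₁,…,Xₙ⟧`, and their
reading on route WildCones' point-blow-up dynamics (`Theorems/WildConesClassicalRegimesDefs.lean`) through
the seat's `polarMatrix` (p502936). NOTHING here is a statement of the manuscript [Hironaka2017]; no
FACT-LIST premise; AI review is weaker than expert review. Cell res-hironaka (LADDER-RESOLUTION rung L,
D-0089), slot W4.6, seat res-L1-s46-pv-4 (gen 5); host route `WildCones`, crux `ClassicalRegimes`
(stmt-ResolutionOfSingularities-16884; proved).

WHY. The near-point criterion (p524988) and the corank-two count (p525636) speak about the tangent cubic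
`a₃ = degForm 3 (ser c)` on the kernel `K` of the polar form. To LINK them with gen 4's invariant
`h₂ = dim 𝔪_A²/𝔪_A³` (p511581), which decided isolatedness of the successors at `e = 2`, one must pass
from ideal-theoretic information (`Σ λₛ ∂ₛa ∈ 𝔪·(∂a) + 𝔪³`, obtained from `h₂ = 3` by a dimension count
in the companion file `…TangentCubicKernel.lean`) to the vanishing of `a₃` and of its polars on `K`. This
file supplies exactly those evaluation rules.

WHAT IS PROVED (every `n`, every field; characteristic `2` only in the last section):

* `degForm_sum`, `degForm_zero'`, `degForm_eq_zero_of_mem_maximalIdeal_pow` (`d < N`, `r ∈ 𝔪^N`);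
* `degForm_one_eq` (`degForm 1 g w = Σ_t [X_t]g · w_t`), `degForm_one_mul_of_constantCoeff_eq_zero`
  (`(h·j)₁ = h(0)·j₁`), `degForm_two_mul` (`(g·j)₂(w) = g₁(w)·j₁(w)` for `g, j ∈ 𝔪`);
* `degForm_one_pderiv` (`(∂ₛf)₁(v) = (linPartials f · v)ₛ`), in characteristic two
  `degForm_one_pderiv_eq_vecMul` (`= (v·P)ₛ`);
* `degForm_one_eq_zero_of_mem_jac`, `degForm_two_eq_zero_of_mem_maximalIdeal_mul_jac` — along a kernel
  vector `v` (`v·P = 0`): every element of `(∂f)` has vanishing linear form at `v`, every element of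
  `𝔪·(∂f) + 𝔪³` has vanishing quadratic form at `v`;
* `degForm_succ_X_mul` (`(X_s g)_{d+1}(w) = w_s · g_d(w)`), `degForm_euler`
  (`Σₛ wₛ (∂ₛf)_d(w) = (d+1) · f_{d+1}(w)`), `degForm_three_eq_polar_self` (char 2:
  `a₃(w) = Σₛ wₛ (∂ₛa)₂(w)` — the cubic is its own polar at the point).

References: folklore (Euler's identity for homogeneous forms); H. Hironaka, ms. 2017 [Hironaka2017] — none
of it used.
-/

noncomputable section

-- single-problem summit: the doubled namespace component `ResolutionOfSingularities` is forced
set_option linter.dupNamespace false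

open scoped BigOperators Classical

open MvPowerSeries IsLocalRing

open Literature.AlgebraicGeometry.Resolution

namespace Summit.ResolutionOfSingularities.ResolutionOfSingularities.Theorems

namespace CampaignW46.HypersurfacesCharTwo

open WildCones WildCones.MuDropCharTwoOrdP ThreefoldsCharTwo

variable {κ : Type} [Field κ] {n : ℕ}

/-! ## Linearity and vanishing on powers of the maximal ideal -/

/-- [OURS · L1 W4.6] The degree form of the zero series vanishes. [folklore] -/
theorem degForm_zero' (d : ℕ) (w : Fin n → κ) : degForm d (0 : MvPowerSeries (Fin n) κ) w = 0 := by
  unfold degForm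
  exact Finset.sum_eq_zero fun A _ => by rw [map_zero, zero_mul]

/-- [OURS · L1 W4.6] The degree form is additive over finite sums. [folklore] -/
theorem degForm_sum {ι : Type} (S : Finset ι) (d : ℕ) (g : ι → MvPowerSeries (Fin n) κ) (w : Fin n → κ) :
    degForm d (∑ s ∈ S, g s) w = ∑ s ∈ S, degForm d (g s) w := by
  induction S using Finset.induction_on with
  | empty => rw [Finset.sum_empty, Finset.sum_empty, degForm_zero']
  | insert b S hb ih => rw [Finset.sum_insert hb, Finset.sum_insert hb, degForm_add, ih]

/-- [OURS · L1 W4.6] `degForm d (C r · g) = r · degForm d g`. [folklore] -/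
theorem degForm_C_mul (d : ℕ) (r : κ) (g : MvPowerSeries (Fin n) κ) (w : Fin n → κ) :
    degForm d (C r * g) w = r * degForm d g w := by
  rw [show C r * g = r • g by rw [MvPowerSeries.c_eq_algebraMap, Algebra.smul_def], degForm_smul]

/-- [OURS · L1 W4.6] **Degree forms vanish on high powers of the maximal ideal**: `r ∈ 𝔪^N`, `d < N`
⇒ `degForm d r w = 0` (all coefficients of degree `d` vanish). [folklore] -/
theorem degForm_eq_zero_of_mem_maximalIdeal_pow {d N : ℕ} (hdN : d < N) {r : MvPowerSeries (Fin n) κ}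
    (hr : r ∈ maximalIdeal (MvPowerSeries (Fin n) κ) ^ N) (w : Fin n → κ) : degForm d r w = 0 := by
  rw [Literature.RingTheory.MvPowerSeries.Jets.mem_maximalIdeal_pow_iff] at hr
  unfold degForm
  refine Finset.sum_eq_zero fun A hA => ?_
  rw [hr A (by rw [mem_finsuppAntidiag_univ_iff_degree'.mp hA]; exact hdN), zero_mul]

/-- [OURS · L1 W4.6] Degree forms only see the class modulo `𝔪^N` (`d < N`). [folklore] -/
theorem degForm_eq_of_sub_mem_maximalIdeal_pow {d N : ℕ} (hdN : d < N) {f g : MvPowerSeries (Fin n) κ}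
    (h : f - g ∈ maximalIdeal (MvPowerSeries (Fin n) κ) ^ N) (w : Fin n → κ) :
    degForm d f w = degForm d g w := by
  have h1 := degForm_eq_zero_of_mem_maximalIdeal_pow hdN h w
  rw [sub_eq_add_neg, degForm_add, show -g = (-1 : κ) • g by rw [neg_one_smul], degForm_smul] at h1
  linear_combination h1

/-! ## The linear form -/

/-- [OURS · L1 W4.6] The exponents of degree one are the `e_t`: a sum over them is a sum over the
variables. [folklore] -/
theorem sum_finsuppAntidiag_one {M : Type} [AddCommMonoid M] (φ : (Fin n →₀ ℕ) → M) :
    ∑ A ∈ (Finset.univ : Finset (Fin n)).finsuppAntidiag 1, φ A = ∑ t, φ (Finsupp.single t 1) := by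
  rw [← Finset.sum_image (f := φ) (s := Finset.univ) (g := fun t : Fin n => Finsupp.single t 1)
    (fun s _ t _ h => (Finsupp.single_left_inj one_ne_zero).mp h)]
  refine Finset.sum_congr ?_ fun _ _ => rfl
  ext A
  rw [mem_finsuppAntidiag_univ_iff_degree', Finset.mem_image]
  constructor
  · intro hA
    obtain ⟨t, ht⟩ := exists_eq_single_of_degree_eq_one hA
    exact ⟨t, Finset.mem_univ t, ht.symm⟩
  · rintro ⟨t, -, rfl⟩
    exact Finsupp.degree_single t 1

/-- [OURS · L1 W4.6] **The degree-one form is the linear part paired with the vector**: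
`degForm 1 g w = Σ_t [X_t] g · w_t`. [folklore] -/
theorem degForm_one_eq (g : MvPowerSeries (Fin n) κ) (w : Fin n → κ) :
    degForm 1 g w = ∑ t, coeff (Finsupp.single t 1) g * w t := by
  unfold degForm
  rw [sum_finsuppAntidiag_one]
  refine Finset.sum_congr rfl fun t _ => ?_
  congr 1
  rw [Finset.prod_eq_single t]
  · rw [Finsupp.single_eq_same, pow_one]
  · intro s _ hs
    rw [Finsupp.single_apply, if_neg (Ne.symm hs), pow_zero]
  · intro h; exact absurd (Finset.mem_univ t) h

/-- [OURS · L1 W4.6] **Lowest form of a product with a factor vanishing at the origin**: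
`degForm 1 (h · j) = h(0) · degForm 1 j` when `j(0) = 0` (`(h − h(0)) · j ∈ 𝔪²`). [folklore] -/
theorem degForm_one_mul_of_constantCoeff_eq_zero (h j : MvPowerSeries (Fin n) κ) (hj : constantCoeff j = 0)
    (w : Fin n → κ) : degForm 1 (h * j) w = constantCoeff h * degForm 1 j w := by
  have hmem : h * j - C (constantCoeff h) * j ∈ maximalIdeal (MvPowerSeries (Fin n) κ) ^ 2 := by
    rw [← sub_mul, pow_two]
    refine Ideal.mul_mem_mul ?_ ?_
    · rw [Literature.RingTheory.MvPowerSeries.Jets.mem_maximalIdeal_iff_constantCoeff_eq_zero, map_sub,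
        constantCoeff_C, sub_self]
    · rw [Literature.RingTheory.MvPowerSeries.Jets.mem_maximalIdeal_iff_constantCoeff_eq_zero, hj]
  rw [degForm_eq_of_sub_mem_maximalIdeal_pow (by norm_num) hmem, degForm_C_mul]

/-- [OURS · L1 W4.6] The linear part of a series vanishing at the origin, as a series. [folklore] -/
theorem sub_linearPart_mem_maximalIdeal_sq {g : MvPowerSeries (Fin n) κ} (hg : constantCoeff g = 0) :
    g - ∑ s, coeff (Finsupp.single s 1) g • (X s : MvPowerSeries (Fin n) κ) ∈
      maximalIdeal (MvPowerSeries (Fin n) κ) ^ 2 :=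
  Literature.RingTheory.MvPowerSeries.Jets.mem_maximalIdeal_pow_of_le_order
    (by exact_mod_cast two_le_order_sub_linear hg)

/-- [OURS · L1 W4.6] The quadratic form of a product of two linear forms `(Σ gₛXₛ)(Σ jₜXₜ)` at `w` is
the product of their values. [folklore] -/
theorem degForm_two_linear_mul_linear (g j : Fin n → κ) (w : Fin n → κ) :
    degForm 2 ((∑ s, g s • (X s : MvPowerSeries (Fin n) κ)) * (∑ t, j t • (X t : MvPowerSeries (Fin n) κ))) w =
      (∑ s, g s * w s) * (∑ t, j t * w t) := by
  rw [Finset.sum_mul_sum, degForm_sum, Finset.sum_mul_sum]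
  refine Finset.sum_congr rfl fun s _ => ?_
  rw [degForm_sum]
  refine Finset.sum_congr rfl fun t _ => ?_
  -- the monomial function `w^{e_s + e_t} = w_s w_t`
  have hprod : ∏ u, w u ^ ((Finsupp.single s 1 + Finsupp.single t 1 : Fin n →₀ ℕ) u) = w s * w t := by
    simp only [Finsupp.coe_add, Pi.add_apply, pow_add, Finset.prod_mul_distrib]
    have h1 : ∀ a : Fin n, ∏ u, w u ^ ((Finsupp.single a 1 : Fin n →₀ ℕ) u) = w a := by
      intro a
      rw [Finset.prod_eq_single a]
      · rw [Finsupp.single_eq_same, pow_one]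
      · intro u _ hu; rw [Finsupp.single_apply, if_neg (Ne.symm hu), pow_zero]
      · intro h; exact absurd (Finset.mem_univ a) h
    rw [h1, h1]
  rw [smul_mul_smul_comm, degForm_smul, X_def, X_def, monomial_mul_monomial, one_mul,
    degForm_monomial (by rw [map_add, Finsupp.degree_single, Finsupp.degree_single]), hprod]
  ring

/-- [OURS · L1 W4.6] **Lowest form of a product of two series vanishing at the origin**:
`degForm 2 (g · j) (w) = degForm 1 g (w) · degForm 1 j (w)` for `g, j ∈ 𝔪` (`g j ≡ g₁ j₁ mod 𝔪³`).
[folklore] -/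
theorem degForm_two_mul {g j : MvPowerSeries (Fin n) κ} (hg : constantCoeff g = 0) (hj : constantCoeff j = 0)
    (w : Fin n → κ) : degForm 2 (g * j) w = degForm 1 g w * degForm 1 j w := by
  set Lg := ∑ s, coeff (Finsupp.single s 1) g • (X s : MvPowerSeries (Fin n) κ) with hLg
  set Lj := ∑ t, coeff (Finsupp.single t 1) j • (X t : MvPowerSeries (Fin n) κ) with hLj
  have hmg : g ∈ maximalIdeal (MvPowerSeries (Fin n) κ) := by
    rwa [Literature.RingTheory.MvPowerSeries.Jets.mem_maximalIdeal_iff_constantCoeff_eq_zero]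
  have hLj1 : Lj ∈ maximalIdeal (MvPowerSeries (Fin n) κ) :=
    Ideal.sum_mem _ fun t _ => Submodule.smul_of_tower_mem _ _
      (Literature.RingTheory.MvPowerSeries.Jets.mem_maximalIdeal_iff_constantCoeff_eq_zero.mpr
        (constantCoeff_X t))
  have hmem : g * j - Lg * Lj ∈ maximalIdeal (MvPowerSeries (Fin n) κ) ^ 3 := by
    have hsplit : g * j - Lg * Lj = g * (j - Lj) + (g - Lg) * Lj := by ring
    rw [hsplit, show (3 : ℕ) = 1 + 2 by norm_num, pow_add, pow_one]
    refine Ideal.add_mem _ (Ideal.mul_mem_mul hmg (sub_linearPart_mem_maximalIdeal_sq hj)) ?_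
    exact Submodule.mul_mem_mul_rev hLj1 (sub_linearPart_mem_maximalIdeal_sq hg)
  rw [degForm_eq_of_sub_mem_maximalIdeal_pow (by norm_num) hmem, hLg, hLj,
    degForm_two_linear_mul_linear, degForm_one_eq, degForm_one_eq]

/-! ## The linear form of a partial derivative is the polar matrix -/

/-- [OURS · L1 W4.6] **The linear form of `∂ₛ f` at `v` is `(linPartials f · v)ₛ`.** [folklore] -/
theorem degForm_one_pderiv (f : MvPowerSeries (Fin n) κ) (s : Fin n) (v : Fin n → κ) :
    degForm 1 (MvPowerSeries.pderiv s f) v = Matrix.mulVec (linPartials f) v s := by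
  rw [degForm_one_eq, Matrix.mulVec, dotProduct]
  rfl

/-- [OURS · L1 W4.6] Characteristic two: **the linear form of `∂ₛ a` at `v` is `(v · P)ₛ`** for the
polar matrix `P`. [folklore] -/
theorem degForm_one_pderiv_eq_vecMul [CharP κ 2] (f : MvPowerSeries (Fin n) κ) (s : Fin n) (v : Fin n → κ) :
    degForm 1 (MvPowerSeries.pderiv s f) v = Matrix.vecMul v (polarMatrix f) s := by
  rw [degForm_one_pderiv, linPartials_eq_polarMatrix, mulVec_polarMatrix_eq_vecMul]

/-- [OURS · L1 W4.6] **Along a kernel vector, every element of the gradient ideal has vanishing linear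
form**: if `degForm 1 (∂ₛ f) v = 0` for all `s` (in characteristic two: `v · P = 0`) and `f` has no
linear terms, then `degForm 1 j v = 0` for every `j ∈ (∂₁f,…,∂ₙf)`. [folklore] -/
theorem degForm_one_eq_zero_of_mem_jac {f : MvPowerSeries (Fin n) κ}
    (hf : ∀ s, coeff (Finsupp.single s 1) f = 0) {v : Fin n → κ}
    (hv : ∀ s, degForm 1 (MvPowerSeries.pderiv s f) v = 0) {j : MvPowerSeries (Fin n) κ}
    (hj : j ∈ Ideal.span (Set.range fun s => MvPowerSeries.pderiv s f)) : degForm 1 j v = 0 := by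
  obtain ⟨c, rfl⟩ := (Submodule.mem_span_range_iff_exists_fun _).mp hj
  rw [degForm_sum]
  refine Finset.sum_eq_zero fun s _ => ?_
  rw [smul_eq_mul, degForm_one_mul_of_constantCoeff_eq_zero _ _ (by rw [constantCoeff_pderiv, hf s]),
    hv s, mul_zero]

/-- [OURS · L1 W4.6] The partials of a series without linear terms vanish at the origin. [folklore] -/
theorem pderiv_mem_maximalIdeal {f : MvPowerSeries (Fin n) κ} (hf : ∀ s, coeff (Finsupp.single s 1) f = 0)
    (s : Fin n) : MvPowerSeries.pderiv s f ∈ maximalIdeal (MvPowerSeries (Fin n) κ) := by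
  rw [Literature.RingTheory.MvPowerSeries.Jets.mem_maximalIdeal_iff_constantCoeff_eq_zero,
    constantCoeff_pderiv, hf s]

/-- [OURS · L1 W4.6] **Along a kernel vector, every element of `𝔪·(∂f) + 𝔪³` has vanishing quadratic
form**: if `degForm 1 (∂ₛ f) v = 0` for all `s` and `f` has no linear terms, then for
`r ∈ 𝔪·(∂₁f,…,∂ₙf) ⊔ 𝔪³`: `degForm 2 r v = 0`. (Products `g·j`, `g ∈ 𝔪`, `j ∈ (∂f)`, have quadratic form
`g₁(v) j₁(v) = 0`.) [folklore] -/
theorem degForm_two_eq_zero_of_mem_maximalIdeal_mul_jac {f : MvPowerSeries (Fin n) κ}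
    (hf : ∀ s, coeff (Finsupp.single s 1) f = 0) {v : Fin n → κ}
    (hv : ∀ s, degForm 1 (MvPowerSeries.pderiv s f) v = 0) {r : MvPowerSeries (Fin n) κ}
    (hr : r ∈ maximalIdeal (MvPowerSeries (Fin n) κ) * Ideal.span (Set.range fun s => MvPowerSeries.pderiv s f) ⊔
      maximalIdeal (MvPowerSeries (Fin n) κ) ^ 3) :
    degForm 2 r v = 0 := by
  obtain ⟨r₁, hr₁, r₂, hr₂, rfl⟩ := Submodule.mem_sup.mp hr
  rw [degForm_add, degForm_eq_zero_of_mem_maximalIdeal_pow (by norm_num) hr₂, add_zero]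
  refine Submodule.mul_induction_on hr₁ (fun g hg j hj => ?_) (fun x y hx hy => by rw [degForm_add, hx, hy, add_zero])
  have hg0 : constantCoeff g = 0 :=
    Literature.RingTheory.MvPowerSeries.Jets.mem_maximalIdeal_iff_constantCoeff_eq_zero.mp hg
  have hj0 : constantCoeff j = 0 :=
    Literature.RingTheory.MvPowerSeries.Jets.mem_maximalIdeal_iff_constantCoeff_eq_zero.mp
      ((Ideal.span_le.mpr (by rintro _ ⟨s, rfl⟩; exact pderiv_mem_maximalIdeal hf s)) hj)
  rw [degForm_two_mul hg0 hj0, degForm_one_eq_zero_of_mem_jac hf hv hj, mul_zero]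

/-! ## Euler's identity -/

/-- [OURS · L1 W4.6] The monomial function splits off a variable: `w^{B + e_s} = w_s · w^B`. [folklore] -/
theorem prod_pow_add_single (w : Fin n → κ) (B : Fin n →₀ ℕ) (s : Fin n) :
    ∏ u, w u ^ ((B + Finsupp.single s 1 : Fin n →₀ ℕ) u) = w s * ∏ u, w u ^ (B u) := by
  simp only [Finsupp.coe_add, Pi.add_apply, pow_add, Finset.prod_mul_distrib]
  rw [mul_comm]
  congr 1
  rw [Finset.prod_eq_single s]
  · rw [Finsupp.single_eq_same, pow_one]
  · intro u _ hu; rw [Finsupp.single_apply, if_neg (Ne.symm hu), pow_zero]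
  · intro h; exact absurd (Finset.mem_univ s) h

/-- [OURS · L1 W4.6] **Multiplying by a variable shifts the degree form**:
`degForm (d+1) (X_s · g) w = w_s · degForm d g w`. [folklore] -/
theorem degForm_succ_X_mul (d : ℕ) (s : Fin n) (g : MvPowerSeries (Fin n) κ) (w : Fin n → κ) :
    degForm (d + 1) (X s * g) w = w s * degForm d g w := by
  unfold degForm
  -- coefficients of `X_s g`
  have hco : ∀ A : Fin n →₀ ℕ, coeff A (X s * g) =
      if Finsupp.single s 1 ≤ A then coeff (A - Finsupp.single s 1) g else 0 := by
    intro A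
    rw [X_def, coeff_monomial_mul]
    by_cases h : Finsupp.single s 1 ≤ A
    · rw [if_pos h, if_pos h, one_mul]
    · rw [if_neg h, if_neg h]
  simp only [hco, ite_mul, zero_mul]
  rw [← Finset.sum_filter, Finset.mul_sum]
  -- reindex `A = B + e_s`
  refine Finset.sum_nbij' (fun A => A - Finsupp.single s 1) (fun B => B + Finsupp.single s 1) ?_ ?_ ?_ ?_ ?_
  · intro A hA
    rw [Finset.mem_filter, mem_finsuppAntidiag_univ_iff_degree'] at hA
    rw [mem_finsuppAntidiag_univ_iff_degree']
    have h := congrArg Finsupp.degree (tsub_add_cancel_of_le hA.2)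
    rw [map_add, Finsupp.degree_single, hA.1] at h
    omega
  · intro B hB
    rw [mem_finsuppAntidiag_univ_iff_degree'] at hB
    rw [Finset.mem_filter, mem_finsuppAntidiag_univ_iff_degree', map_add, Finsupp.degree_single, hB]
    exact ⟨rfl, by rw [add_comm]; exact le_add_right le_rfl⟩
  · intro A hA
    rw [Finset.mem_filter] at hA
    exact tsub_add_cancel_of_le hA.2
  · intro B _
    exact add_tsub_cancel_right B (Finsupp.single s 1)
  · intro A hA
    rw [Finset.mem_filter] at hA
    have hA' : A - Finsupp.single s 1 + Finsupp.single s 1 = A := tsub_add_cancel_of_le hA.2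
    have hp : ∏ u, w u ^ (A u) = w s * ∏ u, w u ^ ((A - Finsupp.single s 1 : Fin n →₀ ℕ) u) := by
      rw [← prod_pow_add_single w (A - Finsupp.single s 1) s, hA']
    rw [hp]
    ring

/-- [OURS · L1 W4.6] **EULER'S IDENTITY for degree forms**: `Σₛ wₛ · degForm d (∂ₛ f) w =
(d + 1) · degForm (d+1) f w` (`Σₛ Xₛ ∂ₛ f` multiplies the coefficient of `X^A` by `|A|`). [folklore] -/
theorem degForm_euler (d : ℕ) (f : MvPowerSeries (Fin n) κ) (w : Fin n → κ) :
    ∑ s, w s * degForm d (MvPowerSeries.pderiv s f) w = ((d : κ) + 1) * degForm (d + 1) f w := by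
  have h1 : ∀ s, w s * degForm d (MvPowerSeries.pderiv s f) w =
      degForm (d + 1) (MvPowerSeries.eulerDerivation s f) w := by
    intro s
    rw [← MvPowerSeries.X_mul_pderiv, degForm_succ_X_mul]
  simp only [h1]
  rw [← degForm_sum]
  unfold degForm
  rw [Finset.mul_sum]
  refine Finset.sum_congr rfl fun A hA => ?_
  rw [map_sum]
  simp only [MvPowerSeries.coeff_eulerDerivation]
  rw [← Finset.sum_mul, ← Nat.cast_sum, ← Finsupp.degree_eq_sum, mem_finsuppAntidiag_univ_iff_degree'.mp hA]
  push_cast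
  ring

/-- [OURS · L1 W4.6] Characteristic two: **THE TANGENT CUBIC IS ITS OWN POLAR AT THE POINT**,
`degForm 3 f w = Σₛ wₛ · degForm 2 (∂ₛ f) w` (Euler with `3 = 1`). [folklore] -/
theorem degForm_three_eq_polar_self [CharP κ 2] (f : MvPowerSeries (Fin n) κ) (w : Fin n → κ) :
    degForm 3 f w = ∑ s, w s * degForm 2 (MvPowerSeries.pderiv s f) w := by
  rw [degForm_euler 2 f w]
  have h3 : ((2 : ℕ) : κ) + 1 = 1 := by
    rw [show ((2 : ℕ) : κ) = 0 from CharP.cast_eq_zero κ 2, zero_add]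
  rw [h3, one_mul]

/-! ## The polar of the tangent cubic -/

/-- [OURS · L1 W4.6] **The directional derivative `Σₛ λₛ ∂ₛ f` lies in the gradient ideal.** [folklore] -/
theorem sum_C_mul_pderiv_mem_jac (f : MvPowerSeries (Fin n) κ) (lam : Fin n → κ) :
    ∑ s, C (lam s) * MvPowerSeries.pderiv s f ∈ Ideal.span (Set.range fun s => MvPowerSeries.pderiv s f) :=
  Ideal.sum_mem _ fun s _ => Ideal.mul_mem_left _ _ (Ideal.subset_span ⟨s, rfl⟩)

/-- [OURS · L1 W4.6] **The quadratic form of the directional derivative is the polar of the cubic**: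
`degForm 2 (Σₛ λₛ ∂ₛ f) v = Σₛ λₛ · degForm 2 (∂ₛ f) v`. [folklore] -/
theorem degForm_two_sum_C_mul_pderiv (f : MvPowerSeries (Fin n) κ) (lam v : Fin n → κ) :
    degForm 2 (∑ s, C (lam s) * MvPowerSeries.pderiv s f) v =
      ∑ s, lam s * degForm 2 (MvPowerSeries.pderiv s f) v := by
  rw [degForm_sum]
  exact Finset.sum_congr rfl fun s _ => degForm_C_mul _ _ _ _

/-- [OURS · L1 W4.6] Characteristic two: **the directional derivative along a KERNEL vector has no
linear and no constant term** — `Σₛ λₛ ∂ₛ a ∈ 𝔪²` when `λ · P = 0` and `a` has order `≥ 2`. [folklore] -/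
theorem sum_C_mul_pderiv_mem_maximalIdeal_sq [CharP κ 2] {f : MvPowerSeries (Fin n) κ} (hf : 2 ≤ f.order)
    {lam : Fin n → κ} (hlam : Matrix.vecMul lam (polarMatrix f) = 0) :
    ∑ s, C (lam s) * MvPowerSeries.pderiv s f ∈ maximalIdeal (MvPowerSeries (Fin n) κ) ^ 2 := by
  have hf' := (FormalCoordChange.two_le_order_iff f).mp hf
  rw [Literature.RingTheory.MvPowerSeries.Jets.mem_maximalIdeal_pow_iff]
  intro e he
  have hdeg : e.degree = 0 ∨ e.degree = 1 := by omega
  rcases hdeg with h0 | h1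
  · rw [Finsupp.degree_eq_zero_iff] at h0
    subst h0
    rw [map_sum]
    refine Finset.sum_eq_zero fun s _ => ?_
    rw [coeff_C_mul, coeff_zero_eq_constantCoeff_apply, constantCoeff_pderiv, hf'.2 s, mul_zero]
  · obtain ⟨t, rfl⟩ := exists_eq_single_of_degree_eq_one h1
    rw [map_sum]
    have h := congrFun hlam t
    rw [Pi.zero_apply, Matrix.vecMul, dotProduct] at h
    rw [← h]
    refine Finset.sum_congr rfl fun s _ => ?_
    rw [coeff_C_mul, ← linPartials_eq_polarMatrix]
    rfl

end CampaignW46.HypersurfacesCharTwo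

end Summit.ResolutionOfSingularities.ResolutionOfSingularities.Theorems

end
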